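import Mathlib
import Summits.Ventures.PercRepro2.OneTypedEdge
import Summits.Ventures.PercRepro2.TypedUntouched

/-!
# The o-probe form of the symmetrised kernel (blind cell PercRepro2, night-3 g15, 2026-08-27;
`proofs/NIGHT3-CERT.md` §24.7)

Every one of the eight terms of `K₃` reads the mark `o` in exactly one factor (`σ_o` in `f₄, f₈`,
`u_o = 1_{o ∈ U}` in `f₃, f₆, f₁₀, f₁₁`). Hence the `S₃`-symmetrised kernel splits by the copy that
carries the o-reading factor (the «probe copy»): on states,

  `KBsym x y z = probeB x y z + probeB y x z + probeB z x y`,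

with `probeB x y z = 1_Q(x) Φ_o(x) [1_PD(y) 1_Q(z) (σ_b(x) − σ_b(z)) + 1_PD(z) 1_Q(y) (σ_b(x) − σ_b(y))]
+ 1_PD(x) u_o(x) [1_Q(y) 1_Q(z) (σ₃(y) − σ₃(z)) (σ_b(y) − σ_b(z)) + 1_Q(y) 1_PD(z) (u_b(z) − u_b(x))
+ 1_Q(z) 1_PD(y) (u_b(y) − u_b(x))]` and `Φ_o = σ_o − u_o σ₃` — the probe copy enters only through
its two o-observables `Φ_o` and `1_PD u_o`. A polynomial identity in the seven state atoms of each
copy (`ring`), no case split. Nothing here asserts anything about the original lane.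
-/

namespace Summit.Ventures.PercRepro2

namespace CovForm

namespace OProbe

open OneTyped Untouched

/-- `Φ_o = σ_o − u_o σ₃` on a state. -/
def phiB (x : St) : ℤ := sigB x.Lo x.Ho - uB x.Lo x.Ho * sigB x.L3 x.H3

/-- The o-probe kernel: the part of `6·K^sym` whose o-reading factor sits in the first copy. -/
def probeB (x y z : St) : ℤ :=
  qB x * phiB x *
      (pdB y * qB z * (sigB x.Lb x.Hb - sigB z.Lb z.Hb) +
        pdB z * qB y * (sigB x.Lb x.Hb - sigB y.Lb y.Hb)) +
    pdB x * uB x.Lo x.Ho *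
      (qB y * qB z * (sigB y.L3 y.H3 - sigB z.L3 z.H3) * (sigB y.Lb y.Hb - sigB z.Lb z.Hb) +
        qB y * pdB z * (uB z.Lb z.Hb - uB x.Lb x.Hb) +
        qB z * pdB y * (uB y.Lb y.Hb - uB x.Lb x.Hb))

/-- **The o-probe form**: the symmetrised kernel is the sum of the three probe kernels. -/
theorem KBsym_eq_probe (x y z : St) :
    KBsym x y z = probeB x y z + probeB y x z + probeB z x y := by
  unfold KBsym KB probeB phiB
  ring

end OProbe

end CovForm

end Summit.Ventures.PercRepro2
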